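import Summits.HodgeConjecture.HodgeConjecture.Theses.PadicSemiregularLift
import Summits.HodgeConjecture.HodgeConjecture.Theorems.PadicSemiregularLiftFormalVectorBundlesAlgebraizeModuleBockstein
import Summits.HodgeConjecture.HodgeConjecture.Theorems.PadicSemiregularLiftFormalVectorBundlesAlgebraizeThickenings
import Literature.AlgebraicGeometry.Modules.SerreVanishingTwist
import Literature.AlgebraicGeometry.Modules.SerreTwistSum
import Literature.AlgebraicGeometry.Modules.SerreTheoremA
import Literature.AlgebraicGeometry.Modules.PushforwardClosedImmersionCoh

/-!
# Serre's vanishing package on a projective `W(k)`-scheme (stub EA of line `chow-zariski-pushforward`)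

Registered stub `stub_serreVanishingPackage` of the reduction skeleton of the crux
`PadicSemiregularLift.FormalVectorBundlesAlgebraize` (stmt-HodgeConjecture-14106): for `Z` projective over
`W = W(k)` (a closed `W`-immersion `ι : Z ↪ ℙⁿ_W`) and the standard affine cover `U_i = Z ∩ D₊(x_i)`, every
vector bundle `F` on the closed subscheme `Z₁ = Z ⊗ W/p` admits a vector bundle `L` on `Z` with an
epimorphism `L ↠ ι₁_* F` and `Ȟ¹(𝒰; 𝓗om(L, ι₁_* F)) = 0`. We take `L = 𝒪_Z(-m) ⊞ ⋯ ⊞ 𝒪_Z(-m)` for `m`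
large (Serre's theorems A and B):

* `G = ι₁_* F` is coherent (`coh_of_isVectorBundle`, `coh_pushforward_of_isClosedImmersion`);
* Serre A (`Literature/AlgebraicGeometry/Modules/SerreTheoremA`) gives global sections `g_j` of the twist
  `G(m)` generating `G` on every `Z_s`, for all large `m`; each `g_j` is a morphism `𝒪_Z(-m) → G`
  (`SerreTwist.homOfTwistSection`, `Modules/SerreTwistHom`), and their sum `L → G` is an epimorphism
  (locally surjective on the basic opens of the charts, `epi_of_locallySurjective`);
* Serre B₁ for the twists (`SerreTwist.exists_forall_subsingleton_cechMH1_twistMod`,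
  `Modules/SerreVanishingTwist`) and `𝓗om(𝒪_Z(-m), G) ≅ G(m)` (`SerreTwist.sheafHomTwistIso`) give
  `Ȟ¹(𝒰; 𝓗om(𝒪_Z(-m), G)) = 0`, propagated over the biproduct (`subsingleton_cechMH1_sheafHom_biprod`,
  `Modules/SheafHomLeft`); `L` is a vector bundle (`isFiniteLocallyFree_serreTwist`, `isFiniteLocallyFree_biprod`).
-/

noncomputable section

-- Summit.HodgeConjecture.HodgeConjecture.… repeats the summit name by the D-0017 layout (Sub = Summit).
set_option linter.dupNamespace false

open CategoryTheory CategoryTheory.Limits AlgebraicGeometry TopologicalSpace Opposite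
open Literature.AlgebraicGeometry.Motives Literature.AlgebraicGeometry.Motives.WittScheme
open Literature.AlgebraicGeometry.Morphisms Literature.AlgebraicGeometry.Morphisms.ProjCech
open Literature.AlgebraicGeometry.Modules Literature.AlgebraicGeometry.Modules.SerreTwist
open Literature.AlgebraicGeometry.Resolution Literature.AlgebraicGeometry.KTheory

namespace Summit.HodgeConjecture.HodgeConjecture.Theorems.FormalVectorBundlesAlgebraize


/-- **Registered stub EA** (`stub_serreVanishingPackage`): Serre's theorems A and B₁ on a projective
`W(k)`-scheme, packaged for the engine of line `chow-zariski-pushforward`. -/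
theorem stub_serreVanishingPackage :
    ∀ (p : ℕ) [Fact p.Prime] (k : Type) [Field k] [CharP k p] [PerfectRing k p]
      (Z : SchemeOver (WittVector p k)), ChowLemmaRing.IsProjOver Z →
      ∃ (ι : Type) (_ : Finite ι) (U : ι → Z.left.Opens),
        (∀ i, IsAffineOpen (U i)) ∧ (⨆ i, U i) = ⊤ ∧
        ∀ (F : (thickening Z 1).left.Modules), IsVectorBundle F →
          ∃ (L : Z.left.Modules), IsVectorBundle L ∧
            (∃ π : L ⟶ (Scheme.Modules.pushforward (thickeningι Z 1)).obj F, Epi π) ∧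
            Subsingleton (CechMH1 Z.hom
              (sheafHom L ((Scheme.Modules.pushforward (thickeningι Z 1)).obj F)) U) := by
  intro p _ k _ _ _ Z hZ
  obtain ⟨n, ιZ, hcl⟩ := hZ
  let ι : Z.left ⟶ PP (WittVector p k) n := ιZ.left
  haveI : IsClosedImmersion ι := hcl
  have hw : strZ ι = Z.hom := Over.w ιZ
  refine ⟨Fin (n + 1), inferInstance, fun i => cover ι i, fun i => isAffineOpen_cover ι i, iSup_cover_eq_top ι, ?_⟩
  intro F hF
  set G : Z.left.Modules := (Scheme.Modules.pushforward (thickeningι Z 1)).obj F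
  haveI : IsClosedImmersion (thickeningι Z 1) := isClosedImmersion_thickeningι Z 1
  have hG : Coh G := coh_pushforward_of_isClosedImmersion (thickeningι Z 1) (coh_of_isVectorBundle hF)
  -- Serre A, then Serre B₁ for the twists, then Serre A again in a large degree
  obtain ⟨mA, hA⟩ := exists_generators ι G hG
  obtain ⟨N₀, g₀, hgen₀⟩ := hA mA le_rfl
  obtain ⟨d₀, hd₀⟩ := exists_forall_subsingleton_cechMH1_twistMod ι G mA g₀ hG.loc hgen₀
  obtain ⟨N, g, hgen⟩ := hA (max mA d₀) (le_max_left _ _)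
  let g' : ℕ → Γ(twistMod ι G (max mA d₀), ⊤) := fun j => if hj : j < N + 1 then g ⟨j, hj⟩ else 0
  have hg' : ∀ j : Fin (N + 1), g' j = g j := fun j => by simp only [g', dif_pos j.2]
  refine ⟨Lpow ι (max mA d₀) N, (isFiniteLocallyFree_Lpow ι (max mA d₀) N).isVectorBundle,
    ⟨piPow ι G (max mA d₀) g' N, ?_⟩, ?_⟩
  · refine epi_piPow ι G (max mA d₀) g' hG.loc N fun i t => ?_
    have h := generates_singleton ι G (max mA d₀) N g hgen i t
    simp only [← hg'] at h
    exact h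
  · rw [← hw]
    exact subsingleton_cechMH1_sheafHom_Lpow ι G (max mA d₀) (strZ ι) (cover ι) (hd₀ (max mA d₀) (le_max_right _ _)) N

end Summit.HodgeConjecture.HodgeConjecture.Theorems.FormalVectorBundlesAlgebraize

end
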